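import Summits.ABC.StewartYu.PadicG3PackClosedHalf
import HarnessLib

/-!
# Cell abc-stewartyu, crux `Y07Odd` (stmt-ABC-19658), line `gen3-slab-odd`: the SHARP (p-adic) coefficient bound `BwP` — `‖den(ℓ,H)⁻¹‖_p ≤ p^{⌊ℓ/(p−1)⌋}`
# (Legendre: `(p−1)·v_p(den) ≤ ℓ`) — and the packages from ONE inequality with `BwP` in place of the archimedean proxy `BwC`

`Summits/ABC/StewartYu/PadicG3PackClosedP.lean` — cell `abc-stewartyu` (seat p2-g4, F-odd lead).  One definition `BwP L₀ m := p^{⌊L₀/(p−1)⌋}·(p^m√p)^{L₀}`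
(so `log BwP ≤ L₀·(log p/(p−1) + G)`, inside the record's allowance `L₀(G+2)`; the proxy `BwC ~ H^{L₀}` of `PadicG3PackClosed` costs `L₀ log H`,
which the record does not budget) and theorems: `sub_one_mul_padicValNat_den_le`, `norm_inv_den_le`, `hBw_closedP`, **`kStepHypU_of_ineqP`**,
**`kStepOddHypU_of_ineqP`**, **`halfStepHypU_of_ineqP`** (verbatim twins of the `…_of_ineq` constructors with `BwP`).  No named fact.

References: Yu. V. Nesterenko, LNM 1819 (2003) (3.8), Lemma 3.1; A.-M. Legendre (valuation of factorials).
-/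

noncomputable section

open NormedSpace Finset Polynomial
open Literature.NumberTheory.Transcendental
open Literature.NumberTheory.Transcendental (FeldmanDelta.den)
open Literature.NumberTheory.Transcendental.FeldmanDelta
open Literature.NumberTheory.Transcendental.PadicCW77 (condExp)
open Literature.NumberTheory.Transcendental.CW77.Setup (Tau tauNorm)
open scoped Nat

namespace Summit.ABC.StewartYu

namespace G3Setup

variable {p : ℕ} [Fact p.Prime] (S : G3Setup p)

/-! ### Legendre for Fel'dman's denominators -/

omit S in
/-- **`(p−1)·v_p(den(N,H)) ≤ N`** (`den = (H!)^{⌊N/H⌋}·(N mod H)!` and `(p−1)·v_p(n!) ≤ n`). [folklore] -/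
theorem sub_one_mul_padicValNat_den_le (N : ℕ) {H : ℕ} (hH : 1 ≤ H) : (p - 1) * padicValNat p (den N H) ≤ N := by
  rw [den_eq N hH]
  have h1 : (H !) ^ (N / H) ≠ 0 := pow_ne_zero _ (Nat.factorial_ne_zero H)
  have h2 : (N % H)! ≠ 0 := Nat.factorial_ne_zero _
  rw [padicValNat.mul h1 h2, padicValNat.pow, mul_add, ← mul_assoc, mul_comm (p - 1) (N / H), mul_assoc]
  have hA := sub_one_mul_padicValNat_factorial (p := p) H
  have hB := sub_one_mul_padicValNat_factorial (p := p) (N % H)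
  have hA' : (p - 1) * padicValNat p (H !) ≤ H := by rw [hA]; exact Nat.sub_le _ _
  have hB' : (p - 1) * padicValNat p ((N % H)!) ≤ N % H := by rw [hB]; exact Nat.sub_le _ _
  calc N / H * ((p - 1) * padicValNat p (H !)) + (p - 1) * padicValNat p ((N % H)!) ≤ N / H * H + N % H :=
        add_le_add (Nat.mul_le_mul_left _ hA') hB'
    _ = N := Nat.div_add_mod' N H

omit S in
/-- **`‖den(N,H)⁻¹‖_p ≤ p^{⌊N/(p−1)⌋}`.** [folklore] -/
theorem norm_inv_den_le (N : ℕ) {H : ℕ} (hH : 1 ≤ H) : ‖((den N H : ℚ_[p]))⁻¹‖ ≤ (p : ℝ) ^ (N / (p - 1)) := by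
  have hp : p.Prime := Fact.out
  have hd0 : (den N H : ℚ_[p]) ≠ 0 := by exact_mod_cast den_ne_zero N H
  rw [norm_inv, Padic.norm_eq_zpow_neg_valuation hd0, Padic.valuation_natCast, zpow_neg, inv_inv, zpow_natCast]
  refine pow_le_pow_right₀ (by exact_mod_cast hp.one_lt.le) ?_
  have h := sub_one_mul_padicValNat_den_le (p := p) N hH
  have hp1 : 0 < p - 1 := by have := hp.two_le; omega
  exact (Nat.le_div_iff_mul_le hp1).mpr (by rw [mul_comm]; exact h)

/-! ### The sharp coefficient bound -/

omit S in
/-- The sharp weighted coefficient bound `BwP = p^{⌊L₀/(p−1)⌋}·(p^m√p)^{L₀}`. [cite: Nesterenko2003, (3.8); shape only] -/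
def BwP (L₀ m : ℕ) : ℝ := (p : ℝ) ^ (L₀ / (p - 1)) * ((p : ℝ) ^ m * Real.sqrt p) ^ L₀

omit [Fact p.Prime] S in
/-- `0 ≤ BwP`. [folklore] -/
theorem BwP_nonneg (L₀ m : ℕ) : 0 ≤ BwP (p := p) L₀ m := by unfold BwP; positivity

/-- **`hBw` with the sharp bound.** [folklore] -/
theorem hBw_closedP (L₀ : ℕ) {H : ℕ} (hH : 1 ≤ H) (Sh lev m : ℕ) (𝔏 : Finset (Fin S.n → ℤ)) :
    ∀ i ∈ S.unk L₀ 𝔏, ∀ t₀ k, ‖(hw (p := p) (S.Rl H Sh lev) i t₀).coeff k‖ * ((p : ℝ) ^ m * Real.sqrt p) ^ k ≤ BwP (p := p) L₀ m := by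
  intro i hi t₀ k
  have hp : p.Prime := Fact.out
  have hi1 : i.1 ≤ L₀ := by
    unfold unk at hi; have := (mem_product.mp hi).1; rw [mem_range] at this; omega
  have hρ1 : (1 : ℝ) ≤ (p : ℝ) ^ m * Real.sqrt p := by
    have hs : 1 ≤ Real.sqrt p := by
      rw [show (1 : ℝ) = Real.sqrt 1 by simp]; exact Real.sqrt_le_sqrt S.one_lt_p.le
    calc (1 : ℝ) = 1 * 1 := (mul_one 1).symm
      _ ≤ _ := mul_le_mul (one_le_pow₀ S.one_lt_p.le) hs zero_le_one (by positivity)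
  refine (S.norm_coeff_hw_Rl_mul_pow_le H Sh lev i t₀ k hρ1).trans ?_
  unfold BwP
  refine mul_le_mul ?_ (pow_le_pow_right₀ hρ1 hi1) (by positivity) (by positivity)
  refine (norm_inv_den_le (p := p) i.1 hH).trans ?_
  exact pow_le_pow_right₀ (by exact_mod_cast hp.one_lt.le) (Nat.div_le_div_right hi1)

/-! ### The packages from one inequality, sharp form -/

/-- **`KStepHypU` from one inequality (sharp `BwP`).** [cite: Nesterenko2003, §4.2; shape only] -/
theorem kStepHypU_of_ineqP {H : ℕ} (hH : 1 ≤ H) (L₀ Sh lev m : ℕ) (𝔏 : Finset (Fin S.n → ℤ)) (L : Fin S.n → ℕ) (P : ℤ)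
    (hP : (0 : ℤ) ≤ P) {N N' T T' t : ℕ} (ht : 1 ≤ t) (hT : T' + t ≤ T)
    (hfinal : ∀ x₁ : ℤ, |x₁| ≤ (N' : ℤ) → ∀ τ : Tau S.n, tauNorm τ + t ≤ T →
      max (BwP (p := p) L₀ m * ‖S.Λ / (S.b S.j₀ : ℚ_[p])‖ * (p : ℝ) ^ ((t - 1) / 2) * (p : ℝ) ^ condExp p (2 * N + 1) t)
        (BwP (p := p) L₀ m / ((p : ℝ) ^ m * Real.sqrt p) ^ ((2 * N + 1) * t)) <
      1 / S.KC (S.unk L₀ 𝔏).card P L₀ H Sh lev L x₁ τ) :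
    S.KStepHypU (S.Rl H Sh lev) (S.unk L₀ 𝔏) L P m N N' T T' := by
  refine ⟨t, BwP (p := p) L₀ m, fun (_ : ℤ) (τ : Tau S.n) => (Nat.lcmUpto H) ^ τ.1, fun (x : ℤ) (τ : Tau S.n) => M0C L₀ H Sh lev x τ.1,
    S.XbC L, fun x τ => S.KC (S.unk L₀ 𝔏).card P L₀ H Sh lev L x τ, ht, hT, BwP_nonneg L₀ m, S.hBw_closedP L₀ hH Sh lev m 𝔏,
    fun _ τ => Nat.one_le_pow _ _ (Nat.lcmUpto_pos H), S.hR_closed hH L₀ Sh lev 𝔏, S.hXb_closed L, ?_, ?_, hfinal⟩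
  · intro x τ
    unfold KC
    have hP' : (0 : ℝ) ≤ P := by exact_mod_cast hP
    have hM : (0 : ℝ) ≤ M0C L₀ H Sh lev x τ.1 := by
      have h0 : (0 : ℤ) ≤ M0C L₀ H Sh lev x τ.1 := by unfold M0C; exact Int.ceil_nonneg (by positivity)
      exact_mod_cast h0
    have hX : (0 : ℝ) ≤ S.XbC L := by
      have h0 : (0 : ℤ) ≤ S.XbC L := by
        unfold XbC
        exact mul_nonneg (by norm_num) (mul_nonneg (sum_nonneg fun j _ => abs_nonneg _) (sum_nonneg fun j _ => by positivity))
      exact_mod_cast h0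
    positivity
  · intro x τ
    show _ ≤ S.KC _ P L₀ H Sh lev L x τ
    unfold KC
    linarith

/-- **`KStepOddHypU` from one inequality (sharp `BwP`).** [cite: Nesterenko2003, §4.2; shape only] -/
theorem kStepOddHypU_of_ineqP {H : ℕ} (hH : 1 ≤ H) (L₀ Sh lev m : ℕ) (𝔏 : Finset (Fin S.n → ℤ)) (L : Fin S.n → ℕ) (P : ℤ)
    (hP : (0 : ℤ) ≤ P) {N N' T T' t : ℕ} (ht : 1 ≤ t) (hT : T' + t ≤ T)
    (hfinal : ∀ x₁ : ℤ, |x₁| ≤ (N' : ℤ) → ∀ τ : Tau S.n, tauNorm τ + t ≤ T →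
      max (BwP (p := p) L₀ m * ‖S.Λ / (S.b S.j₀ : ℚ_[p])‖ * (p : ℝ) ^ ((t - 1) / 2) * (p : ℝ) ^ condExp p (2 * N) t)
        (BwP (p := p) L₀ m / ((p : ℝ) ^ m * Real.sqrt p) ^ ((2 * N) * t)) <
      1 / S.KC (S.unk L₀ 𝔏).card P L₀ H Sh lev L x₁ τ) :
    S.KStepOddHypU (S.Rl H Sh lev) (S.unk L₀ 𝔏) L P m N N' T T' := by
  refine ⟨t, BwP (p := p) L₀ m, fun (_ : ℤ) (τ : Tau S.n) => (Nat.lcmUpto H) ^ τ.1, fun (x : ℤ) (τ : Tau S.n) => M0C L₀ H Sh lev x τ.1,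
    S.XbC L, fun x τ => S.KC (S.unk L₀ 𝔏).card P L₀ H Sh lev L x τ, ht, hT, BwP_nonneg L₀ m, S.hBw_closedP L₀ hH Sh lev m 𝔏,
    fun _ τ => Nat.one_le_pow _ _ (Nat.lcmUpto_pos H), S.hR_closed hH L₀ Sh lev 𝔏, S.hXb_closed L, ?_, ?_, hfinal⟩
  · intro x τ
    unfold KC
    have hP' : (0 : ℝ) ≤ P := by exact_mod_cast hP
    have hM : (0 : ℝ) ≤ M0C L₀ H Sh lev x τ.1 := by
      have h0 : (0 : ℤ) ≤ M0C L₀ H Sh lev x τ.1 := by unfold M0C; exact Int.ceil_nonneg (by positivity)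
      exact_mod_cast h0
    have hX : (0 : ℝ) ≤ S.XbC L := by
      have h0 : (0 : ℤ) ≤ S.XbC L := by
        unfold XbC
        exact mul_nonneg (by norm_num) (mul_nonneg (sum_nonneg fun j _ => abs_nonneg _) (sum_nonneg fun j _ => by positivity))
      exact_mod_cast h0
    positivity
  · intro x τ
    show _ ≤ S.KC _ P L₀ H Sh lev L x τ
    unfold KC
    linarith

/-- **`HalfStepHypU` from one inequality (sharp `BwP`).** [cite: Nesterenko2003, §4.3; shape only] -/
theorem halfStepHypU_of_ineqP {H Sh lev : ℕ} (hH : 1 ≤ H) (hlev : lev < Sh) (L₀ m : ℕ) (𝔏 : Finset (Fin S.n → ℤ)) (L : Fin S.n → ℕ)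
    (P : ℤ) {N N₁ T T' t : ℕ} (ht : 1 ≤ t) (hT : T' + t ≤ T)
    (hineq : ∀ s₁ : ℤ, Odd s₁ → |s₁| ≤ (2 * N₁ - 1 : ℤ) → ∀ τ : Tau S.n, tauNorm τ + t ≤ T →
      max (BwP (p := p) L₀ m * ‖S.Λ / (S.b S.j₀ : ℚ_[p])‖ * (p : ℝ) ^ ((t - 1) / 2) * (p : ℝ) ^ condExp p (2 * N + 1) t)
        (BwP (p := p) L₀ m / ((p : ℝ) ^ m * Real.sqrt p) ^ ((2 * N + 1) * t)) <
      (S.DC L H s₁ τ : ℝ) / (4 * (S.DC L H s₁ τ : ℝ) ^ 2 * (1 + ((S.unk L₀ 𝔏).card : ℝ) * P * S.MhC L L₀ H Sh lev s₁ τ) *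
        CW77.heightProd S.α ^ 3) ^ (2 ^ (S.n + 1))) :
    S.HalfStepHypU (S.Rl H Sh lev) (S.Rl H Sh (lev + 1)) (S.unk L₀ 𝔏) L P m N N₁ T T' := by
  refine ⟨t, BwP (p := p) L₀ m, fun t₀ => (2 : ℚ) ^ t₀, fun s₁ τ => S.DC L H s₁ τ, fun s₁ τ => S.MhC L L₀ H Sh lev s₁ τ,
    ht, hT, BwP_nonneg L₀ m, S.hBw_closedP L₀ hH Sh lev m 𝔏, fun t₀ => pow_ne_zero _ two_ne_zero, ?_, ?_, ?_, ?_, ?_, hineq⟩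
  · intro i _ t₀ s₁
    exact S.hasse_Rl_half (H := H) hlev i t₀ s₁
  · intro s₁ τ
    unfold DC
    exact one_le_mul (one_le_mul (Nat.one_le_pow _ _ (Nat.lcmUpto_pos H)) (Nat.one_le_pow _ _ (Int.natAbs_pos.mpr S.bj₀_ne)))
      (MonomialDen.one_le_monDen _ S.α_ne _)
  · intro s₁ τ
    unfold MhC
    have hM : (0 : ℝ) ≤ M0C L₀ H Sh (lev + 1) s₁ τ.1 := by
      have h0 : (0 : ℤ) ≤ M0C L₀ H Sh (lev + 1) s₁ τ.1 := by unfold M0C; exact Int.ceil_nonneg (by positivity)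
      exact_mod_cast h0
    have hX : (0 : ℝ) ≤ S.XbC L := by
      have h0 : (0 : ℤ) ≤ S.XbC L := by
        unfold XbC
        exact mul_nonneg (by norm_num) (mul_nonneg (sum_nonneg fun j _ => abs_nonneg _) (sum_nonneg fun j _ => by positivity))
      exact_mod_cast h0
    positivity
  · intro s₁ τ i hi w hw
    have hi1 : i.1 ≤ L₀ := by
      unfold unk at hi; have := (mem_product.mp hi).1; rw [mem_range] at this; omega
    have hM := S.M0C_spec (p := p) hH L₀ Sh (lev + 1) i hi1 s₁ τ.1
    exact (S.htermW_clear hH hlev i hw s₁ τ hM (S.hXb_closed L w hw)).1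
  · intro s₁ τ i hi w hw
    have hi1 : i.1 ≤ L₀ := by
      unfold unk at hi; have := (mem_product.mp hi).1; rw [mem_range] at this; omega
    have hM := S.M0C_spec (p := p) hH L₀ Sh (lev + 1) i hi1 s₁ τ.1
    have h := (S.htermW_clear hH hlev i hw s₁ τ hM (S.hXb_closed L w hw)).2
    unfold MhC
    exact h

end G3Setup

end Summit.ABC.StewartYu

end
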